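import Mathlib.Analysis.SpecialFunctions.Pow.Real

/-!
# The fourth-order charge-transfer superexchange `J = 2t_pd⁴/(Δ²U_d) + 4t_pd⁴/(Δ²(2Δ + U_p))`

For a 180° M–O–M bond of a `d⁹`-type transition-metal oxide described by a three-band (d–p)
model with metal–oxygen hopping `t_pd`, charge-transfer energy `Δ`, and on-site repulsions `U_d`
(metal) and `U_p` (oxygen), the nearest-neighbour antiferromagnetic exchange obtained in fourth
order in `t_pd` is printed as
«`J_dd = 2t_pd⁴/(Δ²U_dd) + 4t_pd⁴/(Δ²(2Δ + U_pp))`» — «an expression which includes both the Mott and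
charge transfer limits» [NicaEtAl2020R438tJ, Eq. (1), citing Khomskii, *Transition Metal Compounds*
(CUP 2014)] — and, in the equivalent "effective-hopping" form, as
«`J = 2t²/U_d + 2t²/[Δ + U_p/2]`, with `t = t_pd²/Δ`» [LinEtAl2021La438RIXSJ, Suppl. §VI].
Lin et al. add: «In the charge-transfer limit, the strength of this interaction scales as `t_pd⁴/Δ³`»
[LinEtAl2021La438RIXSJ, p. 4].

This file DEFINES the two printed forms (`ctSuperexchange`, `ctSuperexchangeEff`) and proves the
exact bookkeeping a user of the formula performs; no physics claim about any material is made: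

* §1 the two printed forms are IDENTICAL (`ctSuperexchangeEff_eq`); the Mott term is one half of the
  one-band dictionary value `4t²/U_d` at `t = t_pd²/Δ` (`mottTerm_eq_half_dictionary`) — the factor
  every «which J / which t» comparison between a d–p estimate and a one-band `4t²/U` must carry;
* §2 homogeneity `J(λt_pd) = λ⁴J` and the charge-transfer-limit statements: dropping the Mott term
  (`U_d → ∞`) leaves `4t_pd⁴/(Δ²(2Δ + U_p))`, which at `U_p = 0` is `2t_pd⁴/Δ³` (the printed
  `t_pd⁴/Δ³` scaling), and in general lies between `4t_pd⁴/(Δ²(2Δ+U_p))` and … ; positivity and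
  STRICT ANTITONICITY in each of `Δ`, `U_d`, `U_p` on the physical domain (all positive);
* §3 the located evaluations of the R₄Ni₃O₈ packet (cell hubbard-downfold, lit/REFVALS-2.md §69):
  with the printed Wannier `t_pd = 1.22 eV` [NicaEtAl2020R438tJ, SM Table I] and the printed
  cuprate-analysis `U_d = 8.5`, `U_p = 7.3 eV` [LinEtAl2021La438RIXSJ, Suppl. §VI], the formula gives
  `J ∈ (99.4, 99.5) meV` at `Δ = 3.4 eV` (reproducing the printed «a comparable J of 99 meV»),
  `(92.5, 92.6)` at `Δ = 3.51`, `(68.3, 68.4)` at `Δ = 4.01` and `(55.3, 55.4)` at `Δ = 4.4 eV` — i.e.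
  the by-code spread of the Wannier charge-transfer energy `[3.4, 4.01] eV`
  (`ReducedRPNickelateCounts.deltaW_hull`) ALONE moves this estimate across `(68, 100) meV`, a range
  that contains the measured RIXS value `69(4) meV` at its lower end [LinEtAl2021La438RIXSJ, p. 4].

References: E. M. Nica, J. Krishna, R. Yu, Q. Si, A. S. Botana, O. Erten, Phys. Rev. B 102,
020504(R) (2020), Eq. (1); J. Q. Lin et al., Phys. Rev. Lett. 126, 087001 (2021), p. 4 and
Supplemental Material §VI; D. I. Khomskii, *Transition Metal Compounds* (Cambridge, 2014).
AI-produced formalisation (H21, cell hubbard-downfold, seat lit-2, 2026-08-27); no facts, no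
axioms beyond Mathlib's, no `sorry`.
-/

namespace Literature.MathematicalPhysics.QuantumLattice

noncomputable section

/-! ## 1. The two printed forms and their identity -/

/-- Fourth-order charge-transfer superexchange in the d–p parameters:
`J(t_pd, Δ, U_d, U_p) = 2t_pd⁴/(Δ²U_d) + 4t_pd⁴/(Δ²(2Δ + U_p))`.
[cite: NicaEtAl2020R438tJ, Eq. (1)] -/
def ctSuperexchange (tpd Δ Ud Up : ℝ) : ℝ :=
  2 * tpd ^ 4 / (Δ ^ 2 * Ud) + 4 * tpd ^ 4 / (Δ ^ 2 * (2 * Δ + Up))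

/-- The same exchange in the "effective hopping" form: `J = 2t²/U_d + 2t²/(Δ + U_p/2)` with
`t = t_pd²/Δ`. [cite: LinEtAl2021La438RIXSJ, Suppl. §VI] -/
def ctSuperexchangeEff (tpd Δ Ud Up : ℝ) : ℝ :=
  2 * (tpd ^ 2 / Δ) ^ 2 / Ud + 2 * (tpd ^ 2 / Δ) ^ 2 / (Δ + Up / 2)

/-- The Mott (metal–metal) term `2t_pd⁴/(Δ²U_d)`. [cite: NicaEtAl2020R438tJ, Eq. (1)] -/
def ctMottTerm (tpd Δ Ud : ℝ) : ℝ := 2 * tpd ^ 4 / (Δ ^ 2 * Ud)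

/-- The charge-transfer (oxygen) term `4t_pd⁴/(Δ²(2Δ + U_p))`. [cite: NicaEtAl2020R438tJ, Eq. (1)] -/
def ctTransferTerm (tpd Δ Up : ℝ) : ℝ := 4 * tpd ^ 4 / (Δ ^ 2 * (2 * Δ + Up))

/-- Unfolding. [cite: NicaEtAl2020R438tJ, Eq. (1)] -/
theorem ctSuperexchange_def (tpd Δ Ud Up : ℝ) :
    ctSuperexchange tpd Δ Ud Up =
      2 * tpd ^ 4 / (Δ ^ 2 * Ud) + 4 * tpd ^ 4 / (Δ ^ 2 * (2 * Δ + Up)) := rfl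

/-- Unfolding. [cite: LinEtAl2021La438RIXSJ, Suppl. §VI] -/
theorem ctSuperexchangeEff_def (tpd Δ Ud Up : ℝ) :
    ctSuperexchangeEff tpd Δ Ud Up =
      2 * (tpd ^ 2 / Δ) ^ 2 / Ud + 2 * (tpd ^ 2 / Δ) ^ 2 / (Δ + Up / 2) := rfl

/-- Unfolding. [cite: NicaEtAl2020R438tJ, Eq. (1)] -/
theorem ctMottTerm_def (tpd Δ Ud : ℝ) : ctMottTerm tpd Δ Ud = 2 * tpd ^ 4 / (Δ ^ 2 * Ud) := rfl

/-- Unfolding. [cite: NicaEtAl2020R438tJ, Eq. (1)] -/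
theorem ctTransferTerm_def (tpd Δ Up : ℝ) :
    ctTransferTerm tpd Δ Up = 4 * tpd ^ 4 / (Δ ^ 2 * (2 * Δ + Up)) := rfl

/-- `J` is the sum of its Mott and charge-transfer terms. [cite: NicaEtAl2020R438tJ, Eq. (1)] -/
theorem ctSuperexchange_eq_terms (tpd Δ Ud Up : ℝ) :
    ctSuperexchange tpd Δ Ud Up = ctMottTerm tpd Δ Ud + ctTransferTerm tpd Δ Up := rfl

/-- THE TWO PRINTED FORMS ARE IDENTICAL: `2t²/U_d + 2t²/(Δ + U_p/2)` with `t = t_pd²/Δ` equals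
`2t_pd⁴/(Δ²U_d) + 4t_pd⁴/(Δ²(2Δ + U_p))` (for `Δ ≠ 0`; the second denominators agree up to the
factor `2`). [cite: LinEtAl2021La438RIXSJ, Suppl. §VI] [cite: NicaEtAl2020R438tJ, Eq. (1)] -/
theorem ctSuperexchangeEff_eq {Δ : ℝ} (hΔ : Δ ≠ 0) (tpd Ud Up : ℝ) :
    ctSuperexchangeEff tpd Δ Ud Up = ctSuperexchange tpd Δ Ud Up := by
  rw [ctSuperexchangeEff_def, ctSuperexchange_def]
  have h1 : 2 * (tpd ^ 2 / Δ) ^ 2 / Ud = 2 * tpd ^ 4 / (Δ ^ 2 * Ud) := by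
    rw [div_pow, ← pow_mul]; ring
  have h2 : 2 * (tpd ^ 2 / Δ) ^ 2 / (Δ + Up / 2) = 4 * tpd ^ 4 / (Δ ^ 2 * (2 * Δ + Up)) := by
    by_cases hden : Δ + Up / 2 = 0
    · have h2den : 2 * Δ + Up = 0 := by linarith
      rw [hden, h2den]; simp
    · have h2den : 2 * Δ + Up ≠ 0 := fun h => hden (by linarith)
      field_simp
      ring
  rw [h1, h2]

/-- The Mott term is ONE HALF of the one-band dictionary value `4t²/U_d` at the effective hopping
`t = t_pd²/Δ` — the bookkeeping factor between a d–p fourth-order estimate and a one-band `4t²/U`.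
[cite: NicaEtAl2020R438tJ, Eq. (1)] -/
theorem mottTerm_eq_half_dictionary (tpd Δ Ud : ℝ) :
    ctMottTerm tpd Δ Ud = (1 / 2) * (4 * (tpd ^ 2 / Δ) ^ 2 / Ud) := by
  rw [ctMottTerm_def, div_pow, ← pow_mul]
  ring

/-! ## 2. Homogeneity, the charge-transfer limit, positivity and monotonicity -/

/-- `J` is homogeneous of degree four in `t_pd`: `J(λt_pd) = λ⁴ J(t_pd)`.
[cite: LinEtAl2021La438RIXSJ, p. 4] -/
theorem ctSuperexchange_smul (c tpd Δ Ud Up : ℝ) :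
    ctSuperexchange (c * tpd) Δ Ud Up = c ^ 4 * ctSuperexchange tpd Δ Ud Up := by
  rw [ctSuperexchange_def, ctSuperexchange_def, mul_pow]
  ring

/-- In the charge-transfer limit the Mott term is dropped; at `U_p = 0` the remaining term is
exactly `2t_pd⁴/Δ³` — the printed «scales as `t_pd⁴/Δ³`». [cite: LinEtAl2021La438RIXSJ, p. 4] -/
theorem ctTransferTerm_zero_Up {Δ : ℝ} (hΔ : Δ ≠ 0) (tpd : ℝ) :
    ctTransferTerm tpd Δ 0 = 2 * tpd ^ 4 / Δ ^ 3 := by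
  rw [ctTransferTerm_def, add_zero]
  have hΔ3 : Δ ^ 3 ≠ 0 := pow_ne_zero 3 hΔ
  have hden : Δ ^ 2 * (2 * Δ) ≠ 0 := mul_ne_zero (pow_ne_zero 2 hΔ) (mul_ne_zero two_ne_zero hΔ)
  rw [div_eq_div_iff hden hΔ3]
  ring

/-- … and for `U_p ≥ 0` the charge-transfer term is AT MOST `2t_pd⁴/Δ³` (`Δ > 0`).
[cite: LinEtAl2021La438RIXSJ, p. 4] -/
theorem ctTransferTerm_le_ctLimit {Δ Up : ℝ} (hΔ : 0 < Δ) (hUp : 0 ≤ Up) (tpd : ℝ) :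
    ctTransferTerm tpd Δ Up ≤ 2 * tpd ^ 4 / Δ ^ 3 := by
  rw [ctTransferTerm_def]
  have ht : 0 ≤ tpd ^ 4 := by positivity
  have hΔ2 : 0 < Δ ^ 2 := by positivity
  have hΔ3 : 0 < Δ ^ 3 := by positivity
  rw [div_le_div_iff₀ (by positivity) hΔ3]
  have : Δ ^ 3 = Δ ^ 2 * Δ := by ring
  rw [this]
  nlinarith [mul_nonneg ht (mul_nonneg hΔ2.le hUp)]

/-- Both terms, hence `J`, are positive on the physical domain `t_pd ≠ 0`, `Δ, U_d > 0`, `U_p ≥ 0`.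
[cite: NicaEtAl2020R438tJ, Eq. (1)] -/
theorem ctSuperexchange_pos {tpd Δ Ud Up : ℝ} (ht : tpd ≠ 0) (hΔ : 0 < Δ) (hUd : 0 < Ud)
    (hUp : 0 ≤ Up) : 0 < ctSuperexchange tpd Δ Ud Up := by
  rw [ctSuperexchange_def]
  have ht4 : 0 < tpd ^ 4 := by positivity
  have h1 : 0 < 2 * tpd ^ 4 / (Δ ^ 2 * Ud) := by positivity
  have h2 : 0 < 4 * tpd ^ 4 / (Δ ^ 2 * (2 * Δ + Up)) := by positivity
  linarith

/-- `J` is strictly DECREASING in `U_d` (other arguments fixed, physical domain).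
[cite: NicaEtAl2020R438tJ, Eq. (1)] -/
theorem ctSuperexchange_strictAnti_Ud {tpd Δ Ud₁ Ud₂ Up : ℝ} (ht : tpd ≠ 0) (hΔ : 0 < Δ)
    (hUd₁ : 0 < Ud₁) (h : Ud₁ < Ud₂) :
    ctSuperexchange tpd Δ Ud₂ Up < ctSuperexchange tpd Δ Ud₁ Up := by
  rw [ctSuperexchange_def, ctSuperexchange_def]
  have ht4 : 0 < tpd ^ 4 := by positivity
  have hΔ2 : 0 < Δ ^ 2 := by positivity
  have : 2 * tpd ^ 4 / (Δ ^ 2 * Ud₂) < 2 * tpd ^ 4 / (Δ ^ 2 * Ud₁) := by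
    apply div_lt_div_of_pos_left (by positivity) (by positivity)
    exact mul_lt_mul_of_pos_left h hΔ2
  linarith

/-- `J` is strictly DECREASING in `U_p` (physical domain). [cite: NicaEtAl2020R438tJ, Eq. (1)] -/
theorem ctSuperexchange_strictAnti_Up {tpd Δ Ud Up₁ Up₂ : ℝ} (ht : tpd ≠ 0) (hΔ : 0 < Δ)
    (hUp₁ : 0 ≤ Up₁) (h : Up₁ < Up₂) :
    ctSuperexchange tpd Δ Ud Up₂ < ctSuperexchange tpd Δ Ud Up₁ := by
  rw [ctSuperexchange_def, ctSuperexchange_def]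
  have ht4 : 0 < tpd ^ 4 := by positivity
  have hΔ2 : 0 < Δ ^ 2 := by positivity
  have hd1 : 0 < 2 * Δ + Up₁ := by linarith
  have : 4 * tpd ^ 4 / (Δ ^ 2 * (2 * Δ + Up₂)) < 4 * tpd ^ 4 / (Δ ^ 2 * (2 * Δ + Up₁)) := by
    apply div_lt_div_of_pos_left (by positivity) (by positivity)
    exact mul_lt_mul_of_pos_left (by linarith) hΔ2
  linarith

/-- `J` is strictly DECREASING in the charge-transfer energy `Δ` (physical domain): both
denominators grow with `Δ`. [cite: LinEtAl2021La438RIXSJ, p. 4] -/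
theorem ctSuperexchange_strictAnti_Delta {tpd Δ₁ Δ₂ Ud Up : ℝ} (ht : tpd ≠ 0) (hΔ₁ : 0 < Δ₁)
    (h : Δ₁ < Δ₂) (hUd : 0 < Ud) (hUp : 0 ≤ Up) :
    ctSuperexchange tpd Δ₂ Ud Up < ctSuperexchange tpd Δ₁ Ud Up := by
  rw [ctSuperexchange_def, ctSuperexchange_def]
  have ht4 : 0 < tpd ^ 4 := by positivity
  have hΔ₂ : 0 < Δ₂ := hΔ₁.trans h
  have hsq : Δ₁ ^ 2 < Δ₂ ^ 2 := by nlinarith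
  have h1 : 2 * tpd ^ 4 / (Δ₂ ^ 2 * Ud) < 2 * tpd ^ 4 / (Δ₁ ^ 2 * Ud) := by
    apply div_lt_div_of_pos_left (by positivity) (by positivity)
    exact mul_lt_mul_of_pos_right hsq hUd
  have h2 : 4 * tpd ^ 4 / (Δ₂ ^ 2 * (2 * Δ₂ + Up)) < 4 * tpd ^ 4 / (Δ₁ ^ 2 * (2 * Δ₁ + Up)) := by
    apply div_lt_div_of_pos_left (by positivity) (by positivity)
    have ha : 0 < 2 * Δ₁ + Up := by linarith
    calc Δ₁ ^ 2 * (2 * Δ₁ + Up) < Δ₂ ^ 2 * (2 * Δ₁ + Up) := mul_lt_mul_of_pos_right hsq ha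
      _ ≤ Δ₂ ^ 2 * (2 * Δ₂ + Up) := by
          apply mul_le_mul_of_nonneg_left _ (by positivity); linarith
  linarith

/-! ## 3. Located evaluations (R₄Ni₃O₈ packet): the Wannier-`Δ` spread alone spans `(68, 100) meV` -/

/-- With the printed `t_pd = 1.22 eV`, `U_d = 8.5 eV`, `U_p = 7.3 eV`:
`J(Δ = 3.4) ∈ (0.0994, 0.0995) eV` — the printed «a comparable J of 99 meV» is reproduced at the
paper's rounded `Δ438 ∼ 3.4 eV`. [cite: LinEtAl2021La438RIXSJ, Suppl. §VI]
[cite: NicaEtAl2020R438tJ, SM Table I and p. 2] -/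
theorem la438_J_at_3p4 :
    (0.0994 : ℝ) < ctSuperexchange 1.22 3.4 8.5 7.3 ∧ ctSuperexchange 1.22 3.4 8.5 7.3 < 0.0995 := by
  rw [ctSuperexchange_def]; constructor <;> norm_num

/-- The same at the other located Wannier values: `Δ = 3.51 ⇒ J ∈ (0.0925, 0.0926)`,
`Δ = 4.01 ⇒ J ∈ (0.0683, 0.0684)`, and at the infinite-layer `Δ = 4.4 ⇒ J ∈ (0.0553, 0.0554) eV`.
[cite: NicaEtAl2020R438tJ, SM Table I] [cite: LinEtAl2021La438RIXSJ, Suppl. §VI] -/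
theorem la438_J_by_Delta :
    (0.0925 : ℝ) < ctSuperexchange 1.22 3.51 8.5 7.3 ∧ ctSuperexchange 1.22 3.51 8.5 7.3 < 0.0926 ∧
      (0.0683 : ℝ) < ctSuperexchange 1.22 4.01 8.5 7.3 ∧
        ctSuperexchange 1.22 4.01 8.5 7.3 < 0.0684 ∧
          (0.0553 : ℝ) < ctSuperexchange 1.22 4.4 8.5 7.3 ∧
            ctSuperexchange 1.22 4.4 8.5 7.3 < 0.0554 := by
  rw [ctSuperexchange_def, ctSuperexchange_def, ctSuperexchange_def]
  refine ⟨by norm_num, by norm_num, by norm_num, by norm_num, by norm_num, by norm_num⟩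

/-- Hence, at fixed `t_pd, U_d, U_p`, every Wannier `Δ ∈ [3.4, 4.01] eV` (the by-code hull of the
R₄Ni₃O₈ packet) gives `J ∈ (0.0683, 0.0995) eV` — by antitonicity in `Δ` between the two end-point
evaluations; the measured RIXS `J = 0.069 ± 0.004 eV` meets this range only through its upper half
`[0.0683, 0.073]`. [cite: LinEtAl2021La438RIXSJ, p. 4] [cite: NicaEtAl2020R438tJ, Eq. (1)] -/
theorem la438_J_range_of_Delta_hull {Δ : ℝ} (h₁ : 3.4 ≤ Δ) (h₂ : Δ ≤ 4.01) :
    0.0683 < ctSuperexchange 1.22 Δ 8.5 7.3 ∧ ctSuperexchange 1.22 Δ 8.5 7.3 < 0.0995 := by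
  have ht : (1.22 : ℝ) ≠ 0 := by norm_num
  obtain ⟨hlo, -⟩ := la438_J_by_Delta.2.2
  have hhi := la438_J_at_3p4.2
  constructor
  · rcases eq_or_lt_of_le h₂ with rfl | hlt
    · exact la438_J_by_Delta.2.2.1
    · exact lt_trans la438_J_by_Delta.2.2.1
        (ctSuperexchange_strictAnti_Delta ht (by linarith) hlt (by norm_num) (by norm_num))
  · rcases eq_or_lt_of_le h₁ with h | hlt
    · rw [← h]; exact hhi
    · exact lt_trans
        (ctSuperexchange_strictAnti_Delta ht (by norm_num) hlt (by norm_num) (by norm_num)) hhi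

end

end Literature.MathematicalPhysics.QuantumLattice
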